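import Literature.NumberTheory.EllipticCurves.TowerSaturatedCartesianPresentedProofs
import Literature.NumberTheory.GaloisRepresentations.ContinuousCohomologyConnecting
import Mathlib.GroupTheory.Coset.Card
import HarnessLib

/-!
# The index of the saturated level condition in the image of a finite sub-tower is bounded by the cokernels of the
# sub-tower's reductions; cokernels of `H¹` along a surjection are bounded by `H²` of the kernel (theorems only)

`Proofs` file (THEOREMS ONLY; no definition, no named fact, no instance, no `sorry`) in topic `NumberTheory/EllipticCurves`,
currency of `ZpExtensionEisensteinSelmerStructure` §1 (`Tower.compatibleFamilies`, `Tower.levelCondition`), of the presented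
towers of `TowerLocalH1LiftExactProofs` / `TowerSaturatedCartesianPresentedProofs` (two-index families, Kőnig in constraint
form) and of `ContinuousCohomologyConnecting` (`IsSES.δ₁`).

Setting (the «Fil half» of the local index at `v ∣ p` in clause (B5) `Stmt.readoutIndex` of the shared μ-crux of cell
`pub/bsd-print-x9`, blueprint `HOME/p2/S1-DISCRETE-CONTROL` §2): a tower of abelian groups `(H_j, red_j)` (= `H¹(K_v, W_j)`) with
level-wise cores `C_j` (= the strict ordinary cores `ker (H¹(K_v, W_j) → H¹(K_v, W_j / Fil_j))`), and a FINITE presented tower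
`(G_j, g a b)` (= `H¹(K_v, Fil_j)` with the reductions `g a b = H¹(Fil_a ↠ Fil_b)`, `b ≤ a`) mapping to it by `ι_j : G_j → H_j`
(= `H¹` of the inclusion) compatibly with the reductions, with `ι_j(G_j) ⊆ C_j`.  Then:

* §1 `Tower.exists_forall_range_eq_range` — in the finite group `G_i` the decreasing chain of images `g j i (G_j)`, `j ≥ i`,
  is eventually constant; `Tower.exists_mem_compatibleFamilies_apply_eq_of_forall_mem_range` — an element of `G_i` lying in
  EVERY `g j i (G_j)` is the `i`-component of a compatible family (Kőnig, `exists_mem_compatibleFamilies_of_forall_mem`).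
* §2 **`Tower.natCard_range_quotient_levelCondition_le`** — if `#(G_i ⧸ g j i (G_j)) ≤ B` for all `j ≥ i` then
  **`#(ι_i(G_i) ⧸ ι_i(G_i) ∩ levelCondition red p C i) ≤ B`**: the stable image consists of liftable classes, a compatible
  family of `G` maps under `ι` to a compatible family of `H` inside the cores, i.e. into the (saturated) level condition
  (`Tower.mem_levelCondition_of_forall_mem`).
* §3 **`IsSES.natCard_quotient_range_cohomologyMap_one_le`** — for a short exact sequence `0 → M₁ → M₂ → M₃ → 0` of discrete
  modules with `H²(Γ, M₁)` finite: `#(H¹(Γ, M₃) ⧸ im H¹(Γ, M₂)) ≤ #H²(Γ, M₁)` (exactness at `H¹(Γ, M₃)`: the cokernel embeds by `δ₁`).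

For Howard's `F_𝔮` at `v ∣ p` (§2 with `G_j = H¹(K_v, Fil_v T^{(j)})`, §3 on the rows `0 → Fil_n → Fil_{j+n} → Fil_j → 0`): the part
of the strict ordinary core NOT in the saturated condition `F_𝔮(v)` — hence not in Howard's propagated `H¹_{F_𝔮}(K_v, A_𝔮)` at
finite level — has order `≤ sup_n #H²(K_v, Fil_v T^{(n)})`, which is bounded independently of `m` at `𝔮 = T^m + p` (cyclic-line count).
No summit statement is proved; BSD is not proved by any of this.

References: [Howard2004HeegnerKolyvagin] B. Howard, Compositio Math. 140 (2004), Def. 2.1.1 (propagation), §3.1 (`H¹_ord =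
im H¹(K_v, Fil_v V_𝔮)`), Lemma 3.2.7 and proof of Thm. 2.2.10 (arXiv:1202.6340 p. 15–18); [MazurRubinMemoirs2004] Lemma 3.7.1,
Prop. 5.3.14; [SerreGaloisCohomology1997] I §2.2 (long exact sequence; limits of finite modules); [NeukirchSchmidtWingberg2008]
(1.3.2), Cor. 2.7.6.
-/

noncomputable section

open CategoryTheory Function

universe u v

namespace Literature.NumberTheory.EllipticCurves

namespace Tower

/-! ## §1 Stable images in a finite presented tower; liftability of the stable image -/

variable {G : ℕ → Type u} [∀ j, AddCommGroup (G j)] (g : ∀ a b, G a →+ G b)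

/-- The images `g j i (G_j) ≤ G_i` DECREASE in `j ≥ i` (`g (j+1) i = g j i ∘ g (j+1) j`).
[cite: Howard2004HeegnerKolyvagin, Def. 1.1.3 (arXiv:1202.6340 p. 5: the reductions of Quot(T) compose)] -/
theorem range_le_range_of_le (hcomp : ∀ a b c, c ≤ b → b ≤ a → ∀ w : G a, g b c (g a b w) = g a c w)
    {i j j' : ℕ} (hij : i ≤ j) (hjj' : j ≤ j') : (g j' i).range ≤ (g j i).range := by
  rintro _ ⟨w, rfl⟩
  exact ⟨g j' j w, hcomp _ _ _ hij hjj' w⟩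

/-- **In a FINITE group the decreasing chain of images `g j i (G_j)`, `j ≥ i`, is eventually constant**: there is `j₀ ≥ i` with
`g j i (G_j) = g j₀ i (G_{j₀})` for all `j ≥ j₀` (take `j₀` minimising the order of the image).
[cite: SerreGaloisCohomology1997, Ch. I §2.2 (Mittag-Leffler for finite modules)] [cite: NeukirchSchmidtWingberg2008, Cor. 2.7.6] -/
theorem exists_forall_range_eq_range [∀ j, Finite (G j)]
    (hcomp : ∀ a b c, c ≤ b → b ≤ a → ∀ w : G a, g b c (g a b w) = g a c w) (i : ℕ) :
    ∃ j₀, i ≤ j₀ ∧ ∀ j, j₀ ≤ j → (g j i).range = (g j₀ i).range := by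
  classical
  -- the set of orders of the images `g (i+d) i (G_{i+d})`
  let S : Set ℕ := Set.range fun d : ℕ ↦ Nat.card (g (i + d) i).range
  have hS : S.Nonempty := ⟨_, 0, rfl⟩
  obtain ⟨d₀, hd₀⟩ : sInf S ∈ S := Nat.sInf_mem hS
  have hd₀' : Nat.card (g (i + d₀) i).range = sInf S := hd₀
  refine ⟨i + d₀, Nat.le_add_right i d₀, fun j hj ↦ ?_⟩
  obtain ⟨e, rfl⟩ := Nat.exists_eq_add_of_le hj
  have hle : (g (i + d₀ + e) i).range ≤ (g (i + d₀) i).range :=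
    range_le_range_of_le g hcomp (Nat.le_add_right i d₀) (Nat.le_add_right _ e)
  -- the smaller subgroup has order ≥ the minimum, hence equal order, hence equal
  have hcard : Nat.card (g (i + d₀) i).range ≤ Nat.card (g (i + d₀ + e) i).range := by
    rw [hd₀']
    have hmem : Nat.card (g (i + (d₀ + e)) i).range ∈ S := ⟨d₀ + e, rfl⟩
    rw [← Nat.add_assoc] at hmem
    exact Nat.sInf_le hmem
  exact AddSubgroup.eq_of_le_of_card_ge hle hcard

/-- **An element of `G_i` lying in EVERY image `g j i (G_j)`, `j ≥ i`, is the `i`-component of a compatible family** of the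
tower `(G_j, g (j+1) j)` (Kőnig's lemma in constraint form, `exists_mem_compatibleFamilies_of_forall_mem`, on the
reduction-stable constraint sets «reduces to `y`» above `i`, «is the reduction of `y`» below `i`).
[cite: SerreGaloisCohomology1997, Ch. I §2.2 (H¹ with values in a limit of finite modules)] [cite: NeukirchSchmidtWingberg2008, Cor. 2.7.6] -/
theorem exists_mem_compatibleFamilies_apply_eq_of_forall_mem_range [∀ j, Finite (G j)]
    (hid : ∀ a (w : G a), g a a w = w)
    (hcomp : ∀ a b c, c ≤ b → b ≤ a → ∀ w : G a, g b c (g a b w) = g a c w)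
    (i : ℕ) (y : G i) (hy : ∀ j, i ≤ j → y ∈ (g j i).range) :
    ∃ η ∈ compatibleFamilies (fun j ↦ g (j + 1) j), η i = y := by
  -- constraint sets
  let S : ∀ j, Set (G j) := fun j ↦ {w | (i ≤ j → g j i w = y) ∧ (j < i → w = g i j y)}
  have hne : ∀ j, (S j).Nonempty := by
    intro j
    by_cases hij : i ≤ j
    · obtain ⟨w, hw⟩ := hy j hij
      exact ⟨w, fun _ ↦ hw, fun h ↦ absurd hij (not_le.2 h)⟩
    · refine ⟨g i j y, fun h ↦ absurd h hij, fun _ ↦ rfl⟩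
  have hst : ∀ j, ∀ w ∈ S (j + 1), g (j + 1) j w ∈ S j := by
    intro j w hw
    obtain ⟨hw1, hw2⟩ := hw
    refine ⟨fun hij ↦ ?_, fun hji ↦ ?_⟩
    · rw [hcomp _ _ _ hij (Nat.le_succ j), hw1 (hij.trans (Nat.le_succ j))]
    · rcases Nat.lt_or_ge (j + 1) i with h | h
      · rw [hw2 h, hcomp _ _ _ (Nat.le_succ j) (le_of_lt h)]
      · -- `j + 1 = i`
        have hji' : j + 1 = i := le_antisymm hji h
        subst hji'
        have hwy : w = y := by rw [← hid (j + 1) w]; exact hw1 le_rfl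
        rw [hwy]
  obtain ⟨η, hη, hηS⟩ := exists_mem_compatibleFamilies_of_forall_mem (fun j ↦ g (j + 1) j) S hne hst
  refine ⟨η, hη, ?_⟩
  have h := (hηS i).1 le_rfl
  rwa [hid] at h

/-! ## §2 The index of the level condition in the image of the sub-tower -/

variable {H : ℕ → Type u} [∀ j, AddCommGroup (H j)] (red : ∀ j, H (j + 1) →+ H j)

/-- For subgroups `Y ≤ X` of an abelian group `A`: `#(A ⧸ X) ≤ #(A ⧸ Y)`. [cite: SerreGaloisCohomology1997, Local Fields Ch. XIII §1 (finite index bookkeeping)] -/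
theorem natCard_quotient_le_of_le {A : Type u} [AddCommGroup A] {X Y : AddSubgroup A} (h : Y ≤ X) [Finite (A ⧸ Y)] :
    Nat.card (A ⧸ X) ≤ Nat.card (A ⧸ Y) := by
  refine Nat.card_le_card_of_surjective (QuotientAddGroup.map Y X (AddMonoidHom.id A) fun a ha ↦ h ha) ?_
  intro q
  obtain ⟨a, rfl⟩ := QuotientAddGroup.mk_surjective q
  exact ⟨QuotientAddGroup.mk a, rfl⟩

/-- **`#(ι_i(G_i) ⧸ ι_i(G_i) ∩ levelCondition) ≤ B`.**  Let `(H_j, red_j)` be a tower with cores `C_j`, `(G_j, g a b)` a FINITE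
presented tower with `ι_j : G_j → H_j` compatible with the reductions and `ι_j(G_j) ⊆ C_j`.  If `#(G_i ⧸ g j i (G_j)) ≤ B` for every
`j ≥ i`, then the classes of `ι_i(G_i)` outside the saturated level condition `levelCondition red p C i` have index `≤ B`: the stable
image `g j₀ i (G_{j₀})` (§1) consists of `i`-components of compatible families of `G`, whose images under `ι` are compatible families
of `H` inside the cores, hence in the level condition (`mem_levelCondition_of_forall_mem`).  For Howard's `F_𝔮` at `v ∣ p`:
`H_j = H¹(K_v, W_j)`, `G_j = H¹(K_v, Fil_v W_j)`, `C_j` the strict ordinary cores, `B = sup_n #H²(K_v, Fil_v W_n)` (§3).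
[cite: Howard2004HeegnerKolyvagin, Def. 2.1.1, §3.1 and Lemma 3.2.7 (arXiv:1202.6340 p. 15 L62–66, p. 16)] [cite: MazurRubinMemoirs2004, Lemma 3.7.1] -/
theorem natCard_range_quotient_levelCondition_le [∀ j, Finite (G j)]
    (hid : ∀ a (w : G a), g a a w = w)
    (hcomp : ∀ a b c, c ≤ b → b ≤ a → ∀ w : G a, g b c (g a b w) = g a c w)
    (ι : ∀ j, G j →+ H j) (hι : ∀ j (w : G (j + 1)), red j (ι (j + 1) w) = ι j (g (j + 1) j w))
    (p : ℕ) (C : ∀ j, AddSubgroup (H j)) (hC : ∀ j (w : G j), ι j w ∈ C j) (i : ℕ) (B : ℕ)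
    (hB : ∀ j, i ≤ j → Nat.card (G i ⧸ (g j i).range) ≤ B) :
    Nat.card (↥(ι i).range ⧸ (levelCondition red p C i).addSubgroupOf (ι i).range) ≤ B := by
  classical
  obtain ⟨j₀, hij₀, hstab⟩ := exists_forall_range_eq_range g hcomp i
  -- the stable image maps into the level condition
  have hlift : ∀ y ∈ (g j₀ i).range, ι i y ∈ levelCondition red p C i := by
    intro y hy
    have hall : ∀ j, i ≤ j → y ∈ (g j i).range := by
      intro j hij
      rcases le_total j j₀ with h | h
      · exact range_le_range_of_le g hcomp hij h hy
      · rw [hstab j h]; exact hy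
    obtain ⟨η, hη, hηi⟩ := exists_mem_compatibleFamilies_apply_eq_of_forall_mem_range g hid hcomp i y hall
    rw [mem_compatibleFamilies_iff] at hη
    have hx : ∀ j, red j (ι (j + 1) (η (j + 1))) = ι j (η j) := fun j ↦ by rw [hι, hη]
    have hmem := mem_levelCondition_of_forall_mem red p C (x := fun j ↦ ι j (η j)) hx (fun j ↦ hC j (η j)) i
    rwa [hηi] at hmem
  -- `ι_i(g j₀ i (G_{j₀})) ≤ range ι_i ∩ levelCondition`, as subgroups of `range ι_i`
  let Y : AddSubgroup (ι i).range := ((g j₀ i).range.map (ι i)).addSubgroupOf (ι i).range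
  have hY : Y ≤ (levelCondition red p C i).addSubgroupOf (ι i).range := by
    intro x hx
    rw [AddSubgroup.mem_addSubgroupOf] at hx ⊢
    obtain ⟨y, hy, hyx⟩ := hx
    rw [← hyx]
    exact hlift y hy
  -- `G_i ⧸ g j₀ i (G_{j₀}) ↠ range ι_i ⧸ Y`
  let θ : G i →+ (ι i).range ⧸ Y := (QuotientAddGroup.mk' Y).comp (ι i).rangeRestrict
  have hθ : Function.Surjective θ := by
    rintro q
    obtain ⟨x, rfl⟩ := QuotientAddGroup.mk_surjective q
    obtain ⟨w, hw⟩ := (ι i).rangeRestrict_surjective x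
    exact ⟨w, by rw [← hw]; rfl⟩
  have hker : (g j₀ i).range ≤ θ.ker := by
    rintro _ ⟨w, rfl⟩
    rw [AddMonoidHom.mem_ker]
    change QuotientAddGroup.mk ((ι i).rangeRestrict (g j₀ i w)) = (0 : (ι i).range ⧸ Y)
    rw [QuotientAddGroup.eq_zero_iff, AddSubgroup.mem_addSubgroupOf, AddMonoidHom.coe_rangeRestrict]
    exact ⟨g j₀ i w, ⟨w, rfl⟩, rfl⟩
  let θbar : G i ⧸ (g j₀ i).range →+ (ι i).range ⧸ Y := QuotientAddGroup.lift _ θ hker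
  have hθbar : Function.Surjective θbar := by
    intro q
    obtain ⟨w, rfl⟩ := hθ q
    exact ⟨QuotientAddGroup.mk w, rfl⟩
  haveI : Finite (G i ⧸ (g j₀ i).range) := inferInstance
  haveI : Finite ((ι i).range ⧸ Y) := Finite.of_surjective θbar hθbar
  calc Nat.card (↥(ι i).range ⧸ (levelCondition red p C i).addSubgroupOf (ι i).range)
      ≤ Nat.card ((ι i).range ⧸ Y) := natCard_quotient_le_of_le hY
    _ ≤ Nat.card (G i ⧸ (g j₀ i).range) := Nat.card_le_card_of_surjective θbar hθbar
    _ ≤ B := hB j₀ hij₀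

end Tower

end Literature.NumberTheory.EllipticCurves

/-! ## §3 `#coker (H¹(M₂) → H¹(M₃)) ≤ #H²(M₁)` for a short exact sequence -/

namespace Literature.NumberTheory.GaloisRepresentations

namespace IsSES

open _root_.TopRep _root_.ContRepresentation _root_.ContinuousCohomology

variable {A : Type*} [CommRing A] [TopologicalSpace A]
variable {Γ : Type u} [Group Γ] [TopologicalSpace Γ] [IsTopologicalGroup Γ]
variable {M₁ : Type u} [AddCommGroup M₁] [Module A M₁] [TopologicalSpace M₁] [DiscreteTopology M₁]
  [ContinuousSMul A M₁]
variable {M₂ : Type u} [AddCommGroup M₂] [Module A M₂] [TopologicalSpace M₂] [DiscreteTopology M₂]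
  [ContinuousSMul A M₂]
variable {M₃ : Type u} [AddCommGroup M₃] [Module A M₃] [TopologicalSpace M₃] [DiscreteTopology M₃]
  [ContinuousSMul A M₃]
variable {ρ₁ : ContinuousRep Γ A M₁} {ρ₂ : ContinuousRep Γ A M₂} {ρ₃ : ContinuousRep Γ A M₃}
variable {f : ρ₁.toTopRep ⟶ ρ₂.toTopRep} {g : ρ₂.toTopRep ⟶ ρ₃.toTopRep}

/-- **`#(H¹(Γ, M₃) ⧸ im H¹(Γ, M₂)) ≤ #H²(Γ, M₁)`** for a short exact sequence `0 → M₁ → M₂ → M₃ → 0` of discrete `Γ`-modules with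
`H²(Γ, M₁)` finite: the cokernel of `H¹(g)` embeds into `H²(Γ, M₁)` by the connecting map `δ₁` (`δ₁ ∘ H¹(g) = 0` and exactness at
`H¹(Γ, M₃)`).  [cite: SerreGaloisCohomology1997, Ch. I §2.2 (the cohomology exact sequence)] [cite: NeukirchSchmidtWingberg2008, (1.3.2)] -/
theorem natCard_quotient_range_cohomologyMap_one_le [LocallyCompactSpace Γ] (h : IsSES f g)
    [Finite (continuousCohomology 2 ρ₁.toTopRep)] :
    Finite (continuousCohomology 1 ρ₃.toTopRep ⧸ (cohomologyMap g 1).hom.toAddMonoidHom.range) ∧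
      Nat.card (continuousCohomology 1 ρ₃.toTopRep ⧸ (cohomologyMap g 1).hom.toAddMonoidHom.range) ≤
        Nat.card (continuousCohomology 2 ρ₁.toTopRep) := by
  classical
  -- `δ₁` kills the image of `H¹(g)`, so descends to the cokernel
  have hvanish : ∀ x ∈ (cohomologyMap g 1).hom.toAddMonoidHom.range, h.δ₁.toAddMonoidHom x = 0 := by
    rintro _ ⟨y, rfl⟩
    exact h.δ₁_map_one y
  let δbar : continuousCohomology 1 ρ₃.toTopRep ⧸ (cohomologyMap g 1).hom.toAddMonoidHom.range →+
      continuousCohomology 2 ρ₁.toTopRep :=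
    QuotientAddGroup.lift _ h.δ₁.toAddMonoidHom hvanish
  -- and is injective there, by exactness at `H¹(Γ, M₃)`
  have hinj : Function.Injective δbar := by
    intro a b hab
    obtain ⟨x, rfl⟩ := QuotientAddGroup.mk_surjective a
    obtain ⟨y, rfl⟩ := QuotientAddGroup.mk_surjective b
    have hxy : h.δ₁ (x - y) = 0 := by
      rw [map_sub, sub_eq_zero]
      exact hab
    obtain ⟨z, hz⟩ := h.exists_map_one_eq_of_δ₁_eq_zero (x - y) hxy
    rw [QuotientAddGroup.eq_iff_sub_mem]
    exact ⟨z, hz⟩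
  exact ⟨Finite.of_injective δbar hinj, Nat.card_le_card_of_injective δbar hinj⟩

end IsSES

end Literature.NumberTheory.GaloisRepresentations
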